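import Mathlib
import Summits.Ventures.PercRepro.TriangleCapRegularCellEight

/-!
# PercRepro — THE REGULAR CELL `t = 9 D` ON `10 + (s − t)` VERTICES, EXACTLY: `{bottom, bottom + 8, bottom + 14, bottom + 15, bottom + 16, bottom + 18} ∪ [bottom + 20, bottom + 36 D]`
(p3, gen 55; part 314)

At `ℓ = 9` the row excess `Σ_{rows} k (9 − k)` is `0`, `16` or at least `28` (parts 290–291), at most `72 D`, and NEVER
`34` or `38` (THE THIRD AND FOURTH GAPS `{17, 19}`, `no_seventeen_nine`, `no_nineteen_nine`): with `n_j` rows of size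
`j`, `Σ k (9 − k) = 8 (n₁ + n₈) + 14 (n₂ + n₇) + 18 (n₃ + n₆) + 20 (n₄ + n₅)`; the value `34` forces
`(n₂ + n₇, n₄ + n₅) = (1, 1)` or `(n₁ + n₈, n₃ + n₆) = (2, 1)` (the rest `0`), the value `38` forces
`(n₃ + n₆, n₄ + n₅) = (1, 1)` or `(n₁ + n₈, n₂ + n₇) = (3, 1)`, and in every case `Σ k ≢ 0 (mod 9)`.  The single-block
values are `E₁(9) = {0, 8, 14, 15, 18, 20, 21, 23, …, 36}`; `16 = 8 + 8` and `22 = 8 + 14` need two blocks.  THEOREM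
(`regular_cell_nine`, `9 ≤ D`, `t = 9 D`, `2 t ≤ s`): `j − bottomReg 9 D ∈ {0, 8, 14, 15, 16, 18} ∪ [20, 36 D]` — the
excess set at `ℓ = 9` misses exactly `{1, …, 7, 9, …, 13, 17, 19}`.  Axioms: standard.
-/

namespace PercRepro

namespace TriangleCap

namespace C047

open Finset

/-- The entries of a list in `[1, 9]` give a sequence in `[1, 9]` below the length. -/
theorem getD_bounds_nine (L : List ℕ) (hL : ∀ x ∈ L, 1 ≤ x ∧ x ≤ 9) (i : ℕ) (hi : i < L.length) :
    1 ≤ L.getD i 0 ∧ L.getD i 0 ≤ 9 := by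
  rw [List.getD_eq_getElem L 0 hi]
  exact hL _ (List.getElem_mem hi)

/-- A sum of a function of the row sizes is the sum over the sizes `j ≤ 9` of `n_j · f(j)`. -/
theorem sum_rows_eq_sum_counts_nine (k : ℕ → ℕ) (N : ℕ) (hk : ∀ i, i < N → k i ≤ 9) (f : ℕ → ℕ) :
    ∑ i ∈ range N, f (k i) = ∑ j ∈ range 10, ((range N).filter (fun i => k i = j)).card * f j := by
  rw [← sum_fiberwise_of_maps_to (s := range N) (t := range 10) (g := k) (fun i hi => by
    rw [mem_range] at hi ⊢
    have := hk i hi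
    omega)]
  apply sum_congr rfl
  intro j _
  rw [card_eq_sum_ones, sum_mul, one_mul]
  apply sum_congr rfl
  intro i hi
  rw [mem_filter] at hi
  rw [hi.2]

/-- The row counts at `ℓ = 9`: `Σ k = n₁ + 2 n₂ + … + 9 n₉` and `Σ k (9 − k) = 8 n₁ + 14 n₂ + 18 n₃ + 20 n₄ + 20 n₅ + 18 n₆ + 14 n₇ + 8 n₈`. -/
theorem counts_nine (k : ℕ → ℕ) (N : ℕ) (hk : ∀ i, i < N → 1 ≤ k i ∧ k i ≤ 9) :
    ∑ i ∈ range N, k i = ((range N).filter (fun i => k i = 1)).card + 2 * ((range N).filter (fun i => k i = 2)).card +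
      3 * ((range N).filter (fun i => k i = 3)).card + 4 * ((range N).filter (fun i => k i = 4)).card +
      5 * ((range N).filter (fun i => k i = 5)).card + 6 * ((range N).filter (fun i => k i = 6)).card +
      7 * ((range N).filter (fun i => k i = 7)).card + 8 * ((range N).filter (fun i => k i = 8)).card +
      9 * ((range N).filter (fun i => k i = 9)).card ∧
    ∑ i ∈ range N, k i * (9 - k i) = 8 * ((range N).filter (fun i => k i = 1)).card +
      14 * ((range N).filter (fun i => k i = 2)).card + 18 * ((range N).filter (fun i => k i = 3)).card +
      20 * ((range N).filter (fun i => k i = 4)).card + 20 * ((range N).filter (fun i => k i = 5)).card +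
      18 * ((range N).filter (fun i => k i = 6)).card + 14 * ((range N).filter (fun i => k i = 7)).card +
      8 * ((range N).filter (fun i => k i = 8)).card := by
  have h1 := sum_rows_eq_sum_counts_nine k N (fun i hi => (hk i hi).2) (fun j => j)
  have h2 := sum_rows_eq_sum_counts_nine k N (fun i hi => (hk i hi).2) (fun j => j * (9 - j))
  simp only [sum_range_succ, sum_range_zero] at h1 h2
  norm_num at h1 h2
  constructor
  · rw [h1]; ring
  · rw [h2]; ring

/-- **THE THIRD GAP AT `ℓ = 9`:** `Σ k (9 − k) ≠ 34` when `Σ k = 9 D`. -/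
theorem no_seventeen_nine (D : ℕ) (k : ℕ → ℕ) (N : ℕ) (hk : ∀ i, i < N → 1 ≤ k i ∧ k i ≤ 9)
    (hsum : ∑ i ∈ range N, k i = 9 * D) : ∑ i ∈ range N, k i * (9 - k i) ≠ 34 := by
  intro h34
  obtain ⟨h1, h2⟩ := counts_nine k N hk
  rw [h1] at hsum
  rw [h2] at h34
  set n1 := ((range N).filter (fun i => k i = 1)).card
  set n2 := ((range N).filter (fun i => k i = 2)).card
  set n3 := ((range N).filter (fun i => k i = 3)).card
  set n4 := ((range N).filter (fun i => k i = 4)).card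
  set n5 := ((range N).filter (fun i => k i = 5)).card
  set n6 := ((range N).filter (fun i => k i = 6)).card
  set n7 := ((range N).filter (fun i => k i = 7)).card
  set n8 := ((range N).filter (fun i => k i = 8)).card
  set n9 := ((range N).filter (fun i => k i = 9)).card
  have hb4 : n4 ≤ 1 := by omega
  have hb5 : n5 ≤ 1 := by omega
  have hb3 : n3 ≤ 1 := by omega
  have hb6 : n6 ≤ 1 := by omega
  have hb2 : n2 ≤ 2 := by omega
  have hb7 : n7 ≤ 2 := by omega
  interval_cases n4 <;> interval_cases n5 <;> interval_cases n3 <;> interval_cases n6 <;> interval_cases n2 <;>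
    interval_cases n7 <;> omega

/-- **THE FOURTH GAP AT `ℓ = 9`:** `Σ k (9 − k) ≠ 38` when `Σ k = 9 D`. -/
theorem no_nineteen_nine (D : ℕ) (k : ℕ → ℕ) (N : ℕ) (hk : ∀ i, i < N → 1 ≤ k i ∧ k i ≤ 9)
    (hsum : ∑ i ∈ range N, k i = 9 * D) : ∑ i ∈ range N, k i * (9 - k i) ≠ 38 := by
  intro h38
  obtain ⟨h1, h2⟩ := counts_nine k N hk
  rw [h1] at hsum
  rw [h2] at h38
  set n1 := ((range N).filter (fun i => k i = 1)).card
  set n2 := ((range N).filter (fun i => k i = 2)).card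
  set n3 := ((range N).filter (fun i => k i = 3)).card
  set n4 := ((range N).filter (fun i => k i = 4)).card
  set n5 := ((range N).filter (fun i => k i = 5)).card
  set n6 := ((range N).filter (fun i => k i = 6)).card
  set n7 := ((range N).filter (fun i => k i = 7)).card
  set n8 := ((range N).filter (fun i => k i = 8)).card
  set n9 := ((range N).filter (fun i => k i = 9)).card
  have hb4 : n4 ≤ 1 := by omega
  have hb5 : n5 ≤ 1 := by omega
  have hb3 : n3 ≤ 2 := by omega
  have hb6 : n6 ≤ 2 := by omega
  have hb2 : n2 ≤ 2 := by omega
  have hb7 : n7 ≤ 2 := by omega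
  interval_cases n4 <;> interval_cases n5 <;> interval_cases n3 <;> interval_cases n6 <;> interval_cases n2 <;>
    interval_cases n7 <;> omega

/-- The block of excess `e ∈ {8, 14, 15, 16, 18} ∪ [20, 72]` (rows of nine or eighteen edges): its sizes. -/
def blockNine (e : ℕ) : List ℕ :=
  if e = 8 then [8, 1]
  else if e = 14 then [7, 2]
  else if e = 15 then [7, 1, 1]
  else if e = 16 then [8, 8, 1, 1]
  else if e = 18 then [6, 3]
  else if e = 20 then [6, 2, 1]
  else if e = 21 then [6, 1, 1, 1]
  else if e = 22 then [8, 7, 2, 1]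
  else if e = 23 then [5, 3, 1]
  else if e = 24 then [5, 2, 2]
  else if e = 25 then [5, 2, 1, 1]
  else if e = 26 then [5, 1, 1, 1, 1]
  else if e = 27 then [4, 3, 1, 1]
  else if e = 28 then [4, 2, 2, 1]
  else if e = 29 then [4, 2, 1, 1, 1]
  else if e = 30 then [4, 1, 1, 1, 1, 1]
  else if e = 31 then [3, 2, 2, 1, 1]
  else if e = 32 then [3, 2, 1, 1, 1, 1]
  else if e = 33 then [3, 1, 1, 1, 1, 1, 1]
  else if e = 34 then [2, 2, 1, 1, 1, 1, 1]
  else if e = 35 then [2, 1, 1, 1, 1, 1, 1, 1]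
  else if e = 36 then [1, 1, 1, 1, 1, 1, 1, 1, 1]
  else if e = 37 then [8, 4, 2, 1, 1, 1, 1]
  else if e = 38 then [8, 4, 1, 1, 1, 1, 1, 1]
  else if e = 39 then [8, 3, 2, 2, 1, 1, 1]
  else if e = 40 then [8, 3, 2, 1, 1, 1, 1, 1]
  else if e = 41 then [8, 3, 1, 1, 1, 1, 1, 1, 1]
  else if e = 42 then [8, 2, 2, 1, 1, 1, 1, 1, 1]
  else if e = 43 then [8, 2, 1, 1, 1, 1, 1, 1, 1, 1]
  else if e = 44 then [8, 1, 1, 1, 1, 1, 1, 1, 1, 1, 1]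
  else if e = 45 then [7, 4, 1, 1, 1, 1, 1, 1, 1]
  else if e = 46 then [7, 3, 2, 2, 1, 1, 1, 1]
  else if e = 47 then [7, 3, 2, 1, 1, 1, 1, 1, 1]
  else if e = 48 then [7, 3, 1, 1, 1, 1, 1, 1, 1, 1]
  else if e = 49 then [7, 2, 2, 1, 1, 1, 1, 1, 1, 1]
  else if e = 50 then [7, 2, 1, 1, 1, 1, 1, 1, 1, 1, 1]
  else if e = 51 then [7, 1, 1, 1, 1, 1, 1, 1, 1, 1, 1, 1]
  else if e = 52 then [6, 3, 2, 2, 1, 1, 1, 1, 1]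
  else if e = 53 then [6, 3, 2, 1, 1, 1, 1, 1, 1, 1]
  else if e = 54 then [6, 3, 1, 1, 1, 1, 1, 1, 1, 1, 1]
  else if e = 55 then [6, 2, 2, 1, 1, 1, 1, 1, 1, 1, 1]
  else if e = 56 then [6, 2, 1, 1, 1, 1, 1, 1, 1, 1, 1, 1]
  else if e = 57 then [6, 1, 1, 1, 1, 1, 1, 1, 1, 1, 1, 1, 1]
  else if e = 58 then [5, 3, 2, 1, 1, 1, 1, 1, 1, 1, 1]
  else if e = 59 then [5, 3, 1, 1, 1, 1, 1, 1, 1, 1, 1, 1]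
  else if e = 60 then [5, 2, 2, 1, 1, 1, 1, 1, 1, 1, 1, 1]
  else if e = 61 then [5, 2, 1, 1, 1, 1, 1, 1, 1, 1, 1, 1, 1]
  else if e = 62 then [5, 1, 1, 1, 1, 1, 1, 1, 1, 1, 1, 1, 1, 1]
  else if e = 63 then [4, 3, 1, 1, 1, 1, 1, 1, 1, 1, 1, 1, 1]
  else if e = 64 then [4, 2, 2, 1, 1, 1, 1, 1, 1, 1, 1, 1, 1]
  else if e = 65 then [4, 2, 1, 1, 1, 1, 1, 1, 1, 1, 1, 1, 1, 1]
  else if e = 66 then [4, 1, 1, 1, 1, 1, 1, 1, 1, 1, 1, 1, 1, 1, 1]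
  else if e = 67 then [3, 2, 2, 1, 1, 1, 1, 1, 1, 1, 1, 1, 1, 1]
  else if e = 68 then [3, 2, 1, 1, 1, 1, 1, 1, 1, 1, 1, 1, 1, 1, 1]
  else if e = 69 then [3, 1, 1, 1, 1, 1, 1, 1, 1, 1, 1, 1, 1, 1, 1, 1]
  else if e = 70 then [2, 2, 1, 1, 1, 1, 1, 1, 1, 1, 1, 1, 1, 1, 1, 1]
  else if e = 71 then [2, 1, 1, 1, 1, 1, 1, 1, 1, 1, 1, 1, 1, 1, 1, 1, 1]
  else [1, 1, 1, 1, 1, 1, 1, 1, 1, 1, 1, 1, 1, 1, 1, 1, 1, 1]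

/-- The facts about a block: entries in `[1, 9]`, sum `9` or `18`, excess `Σ k (9 − k) = 2 e`. -/
theorem blockNine_facts (e : ℕ) (he : e = 8 ∨ e = 14 ∨ e = 15 ∨ e = 16 ∨ e = 18 ∨ (20 ≤ e ∧ e ≤ 72)) :
    (∀ x ∈ blockNine e, 1 ≤ x ∧ x ≤ 9) ∧ ((blockNine e).sum = 9 ∨ (blockNine e).sum = 18) ∧
      ((blockNine e).map (fun k => k * (9 - k))).sum = 2 * e := by
  unfold blockNine
  rcases he with rfl | rfl | rfl | rfl | rfl | ⟨he1, he2⟩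
  · simp
  · simp
  · simp
  · simp
  · simp
  · interval_cases e <;> simp

/-- **THE ROWS OF EVERY EXCESS AT `ℓ = 9`:** for `m ∈ {8, 14, 15, 16, 18}` or `20 ≤ m ≤ 36 D` (`2 ≤ D`) there are row
sizes `1 ≤ k i ≤ 9`, `i < N`, with `Σ k = 9 D` and `Σ k (9 − k) = 2 m`. -/
theorem rows_of_excess_nine (D m : ℕ) (hD : 2 ≤ D)
    (hm : m = 8 ∨ m = 14 ∨ m = 15 ∨ m = 16 ∨ m = 18 ∨ (20 ≤ m ∧ m ≤ 36 * D)) :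
    ∃ (N : ℕ) (k : ℕ → ℕ), (∀ i, i < N → 1 ≤ k i ∧ k i ≤ 9) ∧ ∑ i ∈ range N, k i = 9 * D ∧
      ∑ i ∈ range N, k i * (9 - k i) = 2 * m := by
  -- `a` blocks `(1^9)`, the block of `e`, and full rows
  obtain ⟨a, e, hae, he, haD⟩ : ∃ a e, m = 36 * a + e ∧
      (e = 8 ∨ e = 14 ∨ e = 15 ∨ e = 16 ∨ e = 18 ∨ (20 ≤ e ∧ e ≤ 72)) ∧ a + 2 ≤ D := by
    rcases hm with rfl | rfl | rfl | rfl | rfl | ⟨hm1, hm2⟩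
    · exact ⟨0, 8, by ring, by omega, by omega⟩
    · exact ⟨0, 14, by ring, by omega, by omega⟩
    · exact ⟨0, 15, by ring, by omega, by omega⟩
    · exact ⟨0, 16, by ring, by omega, by omega⟩
    · exact ⟨0, 18, by ring, by omega, by omega⟩
    · refine ⟨min ((m - 20) / 36) (D - 2), m - 36 * min ((m - 20) / 36) (D - 2), by omega, ?_, by omega⟩
      right; right; right; right; right
      omega
  obtain ⟨hb1, hb2, hb5⟩ := blockNine_facts e he
  set B := blockNine e with hB
  set c := B.sum / 9 with hc
  have hc' : B.sum = 9 * c := by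
    rcases hb2 with h | h <;> rw [h] at hc ⊢ <;> omega
  have hcD : a + c ≤ D := by
    rcases hb2 with h | h <;> rw [h] at hc <;> omega
  set L := List.replicate (9 * a) 1 ++ B ++ List.replicate (D - a - c) 9 with hL
  have hLmem : ∀ x ∈ L, 1 ≤ x ∧ x ≤ 9 := by
    intro x hx
    rw [hL, List.mem_append, List.mem_append, List.mem_replicate, List.mem_replicate] at hx
    rcases hx with (hx | hx) | hx
    · omega
    · exact hb1 x hx
    · omega
  refine ⟨L.length, fun i => L.getD i 0, fun i hi => getD_bounds_nine L hLmem i hi, ?_, ?_⟩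
  · rw [sum_range_getD L (fun x => x), hL, List.map_append, List.map_append, List.sum_append, List.sum_append,
      List.map_id', List.map_id', List.map_id', List.sum_replicate, List.sum_replicate, hc']
    simp only [smul_eq_mul]
    omega
  · rw [sum_range_getD L (fun k => k * (9 - k)), hL, List.map_append, List.map_append, List.sum_append,
      List.sum_append, List.map_replicate, List.map_replicate, List.sum_replicate, List.sum_replicate, hb5]
    simp only [smul_eq_mul]
    omega

/-- The excess of a row is at most eight times its size: `k (9 − k) ≤ 8 k`. -/
theorem excess_le_eight_mul (k : ℕ) : k * (9 - k) ≤ 8 * k := by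
  rcases Nat.lt_or_ge k 9 with h | h
  · interval_cases k <;> omega
  · rw [Nat.sub_eq_zero_of_le h, mul_zero]
    exact Nat.zero_le _

/-- **THE REGULAR CELL `t = 9 D`, EXACTLY:** for `9 ≤ D`, `t = 9 D`, `2 t ≤ s`, `j` is the band value of a
triangle-free graph on `10 + (s − t)` vertices with `s` edges, a vertex of degree `s − t` and every off-degree `≤ D`
IFF `j − bottomReg 9 D ∈ {0, 8, 14, 15, 16, 18} ∪ [20, 36 D]`. -/
theorem regular_cell_nine (s t D j : ℕ) (hD : 9 ≤ D) (ht : t = 9 * D) (hs : 2 * t ≤ s) :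
    (∃ (H : SimpleGraph (Fin (9 + 1 + (s - t)))) (_ : DecidableRel H.Adj), H.CliqueFree 3 ∧
      H.edgeFinset.card = s ∧ ∃ w, deg H w + t = s ∧ (∀ v, offDeg H w v ≤ D) ∧
        ∑ v, deg H v * deg H v + 2 * (t * (s - t - 1)) + 2 * j = s * (s + 1)) ↔
    (j = bottomReg 9 D ∨ j = bottomReg 9 D + 8 ∨ j = bottomReg 9 D + 14 ∨ j = bottomReg 9 D + 15 ∨
      j = bottomReg 9 D + 16 ∨ j = bottomReg 9 D + 18 ∨ (bottomReg 9 D + 20 ≤ j ∧ j ≤ bottomReg 9 D + 36 * D)) := by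
  subst ht
  have hb := two_mul_bottomReg 9 D (by norm_num) hD
  constructor
  · intro hj
    obtain ⟨N, k, hk, hsum, hid⟩ := (regular_cell_iff s (9 * D) 9 D j (by norm_num) hD rfl hs).mp hj
    have hup : ∑ i ∈ range N, k i * (9 - k i) ≤ 72 * D := by
      calc ∑ i ∈ range N, k i * (9 - k i) ≤ ∑ i ∈ range N, 8 * k i := sum_le_sum (fun i _ => excess_le_eight_mul (k i))
        _ = 8 * ∑ i ∈ range N, k i := by rw [mul_sum]
        _ = 72 * D := by rw [hsum]; ring
    have h17 := no_seventeen_nine D k N hk hsum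
    have h19 := no_nineteen_nine D k N hk hsum
    rcases row_excess_trichotomy 9 D k N (by norm_num) (fun m hm => (hk m hm).1) (fun m hm => (hk m hm).2) hsum
      with h0 | h1 | h2
    · left
      omega
    · right; left
      omega
    · omega
  · intro hj
    have hval : ∀ m, (m = 8 ∨ m = 14 ∨ m = 15 ∨ m = 16 ∨ m = 18 ∨ (20 ≤ m ∧ m ≤ 36 * D)) →
        (∃ (H : SimpleGraph (Fin (9 + 1 + (s - 9 * D)))) (_ : DecidableRel H.Adj), H.CliqueFree 3 ∧
          H.edgeFinset.card = s ∧ ∃ w, deg H w + 9 * D = s ∧ (∀ v, offDeg H w v ≤ D) ∧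
            ∑ v, deg H v * deg H v + 2 * (9 * D * (s - 9 * D - 1)) + 2 * (bottomReg 9 D + m) = s * (s + 1)) := by
      intro m hm
      apply (regular_cell_iff s (9 * D) 9 D _ (by norm_num) hD rfl hs).mpr
      obtain ⟨N, k, hk, hsum, hex⟩ := rows_of_excess_nine D m (by omega) hm
      refine ⟨N, k, hk, hsum, ?_⟩
      rw [hex]
      omega
    rcases hj with rfl | rfl | rfl | rfl | rfl | rfl | ⟨hlo, hhi⟩
    · exact ((regular_cell_first_gap s (9 * D) 9 D (by norm_num) hD rfl hs).2.1)
    · exact hval 8 (by omega)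
    · exact hval 14 (by omega)
    · exact hval 15 (by omega)
    · exact hval 16 (by omega)
    · exact hval 18 (by omega)
    · have := hval (j - bottomReg 9 D) (by omega)
      rwa [Nat.add_sub_cancel' (by omega : bottomReg 9 D ≤ j)] at this

end C047

end TriangleCap

end PercRepro
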